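import Summits.HubbardSuperconductivity.HubbardSuperconductivity.Theses.PolyaSchurPairBoson
import Summits.HubbardSuperconductivity.HubbardSuperconductivity.Theses.AnisotropyChord
import Summits.HubbardSuperconductivity.HubbardSuperconductivity.Theses.PlaquetteBoson

/-!
# Crux `PolyaSchurPairBoson.DressAnyFilling` (stmt-HubbardSuperconductivity-10291) — STRATEGY CENSUS,
# kernel-checked companion (crux-strategist REDIRECT r1, 2026-08-17)

Companion of `Cruxes/DressAnyFilling/STRATEGY-CENSUS.md`.  Everything here is pure logic / elementary real
arithmetic on the LITERAL route terms of `Theses/PolyaSchurPairBoson.lean`, `Theses/AnisotropyChord.lean`,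
`Theses/PlaquetteBoson.lean`; no definition of mathematical content and no named fact is introduced.

What is recorded (the verdict's load-bearing facts):

* §1 normal forms — `DressAnyFilling` IS the implication `EasyPlaneCondensate → AnchorOrder`
  (stmt-10288 → stmt-0905), and the three routes' `AnchorOrder` decls are one statement (`Iff.rfl`);
* §2 DOMINATION — `AnchorOrder → DressAnyFilling` and, the fact this census turns on,
  `AnisotropyChord.DressHalfFilled → DressAnyFilling` (stmt-8148 ⇒ stmt-10291: the any-filling hypothesis
  contains the half-filled one, `ρ = 1/2`), first checked by the strategist of stmt-0905 in
  `Cruxes/PbAnchorOrder/SplitGlue.lean` and re-proved here self-containedly; given the bosonic hypothesis the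
  crux is EQUIVALENT to the anchor (`dressAnyFilling_iff_anchorOrder_of_easyPlane`);
* §3 the ROUTE-LEVEL consequence — the route's deciding theorem fires with stmt-8148 in place of stmt-10291
  (`closes_via_dressHalfFilled`), so the route's cone can share the one staffed dressing item of
  `AnisotropyChord` / `LevyLogBootstrap` instead of carrying its own;
* §4 typed restatements used under the census headings (two-place `DressAt U`, the dilute strengthening
  `DressEverySmallFilling`) with their one-line relations to the crux — recorded so that nobody files them
  as new lines: each has the same open content (the dressing) as the crux.

NOT recordable as theorems (they must FAIL): the BC2 probes `DressAnyFilling → HubbardSuperconductivity` and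
`HubbardSuperconductivity → DressAnyFilling` (folder `bc/DressAnyFilling_probe_{CS,SC}.lean`, farm rc 1,
unsolved goals; `bc/DressAnyFilling_cruxprobe.lean`: `#h21_crux_probe … route := …` VERDICT CLEAN, P5 C→S 7/7
and S→C 6/6 attempts fail) — quoted in the census §1.
-/

set_option linter.dupNamespace false

noncomputable section

namespace Summit.HubbardSuperconductivity.HubbardSuperconductivity.Cruxes.DressAnyFilling.Census

open scoped BigOperators Matrix ComplexOrder
open Matrix Complex Finset
open Literature.MathematicalPhysics.QuantumLattice Literature.Probability.LatticeModels
open Summit.HubbardSuperconductivity.HubbardSuperconductivity.Theses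
open Summit.HubbardSuperconductivity.HubbardSuperconductivity.Theses.PolyaSchurPairBoson

/-! ## §1 Normal forms -/

/-- `DressAnyFilling` (stmt-10291) is literally `EasyPlaneCondensate → AnchorOrder` (stmt-10288 → stmt-0905).
[bookkeeping] -/
theorem dressAnyFilling_iff : DressAnyFilling ↔ (EasyPlaneCondensate → AnchorOrder) :=
  Iff.rfl

/-- The route's `AnchorOrder` is the shared item stmt-0905 under its `PlaquetteBoson` name. [bookkeeping] -/
theorem anchorOrder_iff_pb : AnchorOrder ↔ PlaquetteBoson.PbAnchorOrder :=
  Iff.rfl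

/-- … and under its `AnisotropyChord` name. [bookkeeping] -/
theorem anchorOrder_iff_ac : AnchorOrder ↔ AnisotropyChord.AnchorOrder :=
  Iff.rfl

/-- `AnisotropyChord.DressHalfFilled` (stmt-8148) is literally `HalfFilledOrder → AnchorOrder`
(stmt-0906 → stmt-0905). [bookkeeping] -/
theorem dressHalfFilled_iff :
    AnisotropyChord.DressHalfFilled ↔ (AnisotropyChord.HalfFilledOrder → AnchorOrder) :=
  Iff.rfl

/-! ## §2 Domination: the crux is implied by the anchor and by the half-filled dressing item -/

/-- `AnchorOrder → DressAnyFilling`: as an ITEM the crux is the anchor modulo its bosonic antecedent.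
[bookkeeping] -/
theorem dressAnyFilling_of_anchorOrder (hA : AnchorOrder) : DressAnyFilling :=
  fun _ => hA

/-- For even `M`, the half-filled boson number `N = M²/2` is a natural number with `(N : ℝ) = M²/2`.
[folklore] -/
private theorem halfFilled_count (M : ℕ) (hM : Even M) :
    ∃ N : ℕ, 2 * N = M ^ 2 ∧ ((N : ℝ) - (M : ℝ) ^ 2 / 2) = 0 ∧ (1 / 2 : ℝ) * (M : ℝ) ^ 2 ≤ (N : ℝ) := by
  obtain ⟨k, rfl⟩ := hM
  refine ⟨2 * k ^ 2, by ring, ?_, ?_⟩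
  · push_cast; ring
  · push_cast; nlinarith [sq_nonneg (k : ℝ)]

/-- **`EasyPlaneCondensate → HalfFilledOrder`** (stmt-10288 ⇒ stmt-0906): instantiate the filling window at
`ρ = 1/2`, where the only admissible boson number is `N = M²/2` and the sector label `N − M²/2` is `0`.
[bookkeeping] -/
theorem halfFilledOrder_of_easyPlaneCondensate (h : EasyPlaneCondensate) :
    AnisotropyChord.HalfFilledOrder := by
  intro Δ hΔ
  obtain ⟨c, hc, M₀, hM₀⟩ := h Δ hΔ (1 / 2) ⟨by norm_num, by norm_num⟩
  refine ⟨c, hc, M₀, ?_⟩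
  intro M _ hME hMM ψ hψ hψ1 hH
  obtain ⟨N, h2N, hN0, hρN⟩ := halfFilled_count M hME
  have key := hM₀ M hME hMM N hρN (by exact_mod_cast h2N.le) ψ
  rw [hN0] at key
  exact key hψ hψ1 hH

/-- **DOMINATION `DressHalfFilled → DressAnyFilling`** (stmt-8148 ⇒ stmt-10291): a proof of the half-filled
dressing item closes this crux in one line.  (First checked as `dressAnyFilling_of_dressHalfFilled` in
`Cruxes/PbAnchorOrder/SplitGlue.lean` by the strategist of stmt-0905; re-proved here without that import.)
[bookkeeping] -/
theorem dressAnyFilling_of_dressHalfFilled (hD : AnisotropyChord.DressHalfFilled) : DressAnyFilling :=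
  fun hE => hD (halfFilledOrder_of_easyPlaneCondensate hE)

/-- Given the bosonic hypothesis, the crux is EQUIVALENT to the anchor stmt-0905. [bookkeeping] -/
theorem dressAnyFilling_iff_anchorOrder_of_easyPlane (hE : EasyPlaneCondensate) :
    DressAnyFilling ↔ AnchorOrder :=
  ⟨fun hD => hD hE, fun hA _ => hA⟩

/-- Given the bosonic hypothesis, the two dressing items stmt-8148 and stmt-10291 are EQUIVALENT (both are then
the anchor). [bookkeeping] -/
theorem dressAnyFilling_iff_dressHalfFilled_of_easyPlane (hE : EasyPlaneCondensate) :
    DressAnyFilling ↔ AnisotropyChord.DressHalfFilled :=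
  ⟨fun hD => dressHalfFilled_iff.mpr fun _ => hD hE, dressAnyFilling_of_dressHalfFilled⟩

/-! ## §3 Route-level consequence: the deciding theorem fires with stmt-8148 in place of stmt-10291 -/

/-- The route `PolyaSchurPairBoson` decides the summit from `EasyPlaneCondensate`, the HALF-FILLED dressing item
of `AnisotropyChord`/`LevyLogBootstrap` and `Continuation` — i.e. stmt-10291 is replaceable by stmt-8148 in
the cone of `closes` (a tenure `--closes-file` edit; nothing is edited here). [bookkeeping] -/
theorem closes_via_dressHalfFilled (hT : EasyPlaneCondensate) (hD : AnisotropyChord.DressHalfFilled)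
    (hC : Continuation) : _root_.HubbardSuperconductivity :=
  closes hT (dressAnyFilling_of_dressHalfFilled hD) hC

/-! ## §4 Typed restatements met under the census headings (same open content as the crux) -/

/-- The crux's consequent at a GIVEN coupling and doping (verbatim the body of `AnchorOrder` with `U, δ`
free; identical text to `Cruxes/DressAnyFilling/Lines/birth.lean`'s `AnchorAt`). [folklore] -/
def AnchorAt (U δ : ℝ) : Prop :=
  ∃ t₀ : ℝ, 0 < t₀ ∧ ∀ t' ∈ Set.Ioo (0:ℝ) t₀, ∃ c : ℝ, 0 < c ∧ ∃ L₀ : ℕ, ∀ (L : ℕ) [NeZero L], L₀ ≤ L → 4 ∣ L → ∀ (N : ℕ) (ψ : Literature.MathematicalPhysics.QuantumLattice.Fock (Literature.MathematicalPhysics.QuantumLattice.Orb (Literature.MathematicalPhysics.QuantumLattice.FermionTorus 2 L))), N = 2 * ⌊(1 - δ) * (L : ℝ) ^ 2 / 2⌋₊ → star ψ ⬝ᵥ ψ = 1 → Literature.MathematicalPhysics.QuantumLattice.IsGroundStateInSector (Literature.MathematicalPhysics.QuantumLattice.hamiltonian ((Literature.MathematicalPhysics.QuantumLattice.fermionTorusGraph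 2 L) \ SimpleGraph.comap (fun x : Literature.MathematicalPhysics.QuantumLattice.FermionTorus 2 L => fun i : Fin 2 => ((ofLex x) i : ℕ) / 2) ⊤) 1 U + Literature.MathematicalPhysics.QuantumLattice.hamiltonian ((Literature.MathematicalPhysics.QuantumLattice.fermionTorusGraph 2 L) ⊓ SimpleGraph.comap (fun x : Literature.MathematicalPhysics.QuantumLattice.FermionTorus 2 L => fun i : Fin 2 => ((ofLex x) i : ℕ) / 2) ⊤) t' 0) N 0 ψ → c * (L : ℝ) ^ 4 ≤ (Literature.MathematicalPhysics.QuantumLattice.expect ((Literature.MathematicalPhysics.QuantumLattice.pairField Literature.MathematicalPhysics.QuantumLattice.dWaveFormFactor L)ᴴ * Literature.MathematicalPhysics.QuantumLattice.pairField Literature.MathematicalPhysics.QuantumLattice.dWaveFormFactor L) ψ).re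

/-- `AnchorOrder` is `∃ U > 0, ∃ δ ∈ (0,1/2), AnchorAt U δ`. [bookkeeping] -/
theorem anchorOrder_iff_exists_anchorAt :
    AnchorOrder ↔ ∃ U : ℝ, 0 < U ∧ ∃ δ ∈ Set.Ioo (0:ℝ) (1/2), AnchorAt U δ :=
  Iff.rfl

/-- **Two-place restatement `DressAt U`** (census §Decomposition D2 / the tenure repair R2 of the 0907 census):
dress at a NAMED coupling — the `∃ U` of the crux is discharged by the certified window (W1 holds at
`U = 2`: `V/2J ∈ [0.99281, 0.99283]`, evidence EVIDENCE-W1-*.md on the item), so the open content is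
pointwise in `U`. [folklore] -/
def DressAt (U : ℝ) : Prop :=
  EasyPlaneCondensate → ∃ δ ∈ Set.Ioo (0:ℝ) (1/2), AnchorAt U δ

/-- `DressAt U → DressAnyFilling` for any `U > 0`. [bookkeeping] -/
theorem dressAnyFilling_of_dressAt {U : ℝ} (hU : 0 < U) (h : DressAt U) : DressAnyFilling :=
  fun hE => ⟨U, hU, h hE⟩

/-- **Dilute strengthening `DressEverySmallFilling`** (census §Strengthen S⁺₃): dress at EVERY sufficiently
small doping at one coupling — the form a dilute-gas mechanism would prove if one existed. [folklore] -/
def DressEverySmallFilling : Prop :=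
  EasyPlaneCondensate → ∃ U : ℝ, 0 < U ∧ ∃ δ₀ ∈ Set.Ioc (0:ℝ) (1/2), ∀ δ ∈ Set.Ioo (0:ℝ) δ₀, AnchorAt U δ

/-- `DressEverySmallFilling → DressAnyFilling` (take `δ = δ₀/2`). [bookkeeping] -/
theorem dressAnyFilling_of_dressEverySmallFilling (h : DressEverySmallFilling) : DressAnyFilling := by
  intro hE
  obtain ⟨U, hU, δ₀, ⟨hδ₀, hδ₀h⟩, hδ⟩ := h hE
  refine ⟨U, hU, δ₀ / 2, ⟨by linarith, by linarith⟩, hδ (δ₀ / 2) ⟨by linarith, by linarith⟩⟩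

/-- **Strengthening by weakening the hypothesis to ONE anisotropy**: `DressAtAnisotropy Δ₁` — dress from the
condensate at a single `Δ₁ ∈ (-1,0]` and every filling (the form every filed dressing mechanism actually
consumes: the hypothesis is used only at the lock-in `Δ_eff(U)`; nothing is absorbed into `Δ`). [folklore] -/
def DressAtAnisotropy (Δ₁ : ℝ) : Prop :=
  (∀ ρ ∈ Set.Ioc (0:ℝ) (1/2), ∃ c : ℝ, 0 < c ∧ ∃ M₀ : ℕ, ∀ (M : ℕ) [NeZero M], Even M → M₀ ≤ M → ∀ N : ℕ, ρ * (M : ℝ) ^ 2 ≤ (N : ℝ) → 2 * N ≤ M ^ 2 → ∀ (ψ : Literature.MathematicalPhysics.QuantumLattice.TensorIndex (Literature.Probability.LatticeModels.TorusSite 2 M) 2 → ℂ), ψ ∈ Literature.MathematicalPhysics.QuantumLattice.spinZSector (Λ := Literature.Probability.LatticeModels.TorusSite 2 M) 1 ((N : ℝ) - (M : ℝ) ^ 2 / 2) → star ψ ⬝ᵥ ψ = 1 → Matrix.mulVec (Literature.MathematicalPhysics.QuantumLattice.xxzHamiltonian 1 (Literature.Probability.LatticeModels.torusGraph 2 M)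 (-1) Δ₁) ψ = ((Literature.MathematicalPhysics.QuantumLattice.lowestEnergyInSector 1 (Literature.MathematicalPhysics.QuantumLattice.xxzHamiltonian 1 (Literature.Probability.LatticeModels.torusGraph 2 M) (-1) Δ₁) ((N : ℝ) - (M : ℝ) ^ 2 / 2) : ℝ) : ℂ) • ψ → c * (M : ℝ) ^ 4 ≤ (star ψ ⬝ᵥ Matrix.mulVec ((∑ x : Literature.Probability.LatticeModels.TorusSite 2 M, Literature.MathematicalPhysics.QuantumLattice.onSite x (Literature.MathematicalPhysics.QuantumLattice.spinRaise 1)) * (∑ y : Literature.Probability.LatticeModels.TorusSite 2 M, Literature.MathematicalPhysics.QuantumLattice.onSite y (Literature.MathematicalPhysics.QuantumLattice.spinLower 1))) ψ).re) → AnchorOrder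

/-- `DressAtAnisotropy Δ₁ → DressAnyFilling` for any `Δ₁ ∈ (-1,0]` (instantiate the crux hypothesis at `Δ₁`).
[bookkeeping] -/
theorem dressAnyFilling_of_dressAtAnisotropy {Δ₁ : ℝ} (hΔ₁ : Δ₁ ∈ Set.Ioc (-1:ℝ) 0)
    (h : DressAtAnisotropy Δ₁) : DressAnyFilling :=
  fun hE => h (hE Δ₁ hΔ₁)

end Summit.HubbardSuperconductivity.HubbardSuperconductivity.Cruxes.DressAnyFilling.Census

end
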